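import Mathlib
import HarnessLib
import Literature.MathematicalPhysics.StatisticalMechanics.RGStepABKM
import Literature.MathematicalPhysics.StatisticalMechanics.RenormalisationMapBallActivityABKMQ
import Literature.MathematicalPhysics.StatisticalMechanics.StepOperatorBABKMQ

/-!
# [ABKM19] Theorem 6.8 as `RGFlow.IsRGStepQ` for the torus data with STEP KERNELS BY PREDICATE
# (`q ∈ B_κ`): the renormalisation maps `T_k^{(q)}` measured in the norms of the `q = 0` weights

`RGStepABKM.isRGStepQ_abkm` is Theorem 6.8 of [ABKM19] in the form consumed by the fine-tuning engine
`RGFlow.exists_tuned_of_normBound` / `RGFlow.exists_isTunedQ_initial_eq` (Ch. 12), for the steps whose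
fluctuation kernel EQUALS the weight kernel (`q = 0`).  Lemma 12.6 compares the systems
`(A^ℋ, B^ℋ, S^ℋ)`, `ℋ` small, in ONE family of norm predicates — those of the `q = 0` weights —
while `S^ℋ_k` integrates against `μ^{(q(ℋ))}_{k+1}`.  This file provides exactly that: for any family
of step kernels `𝒞s` with `StepKernelBounds W L k A𝒫' C₂ (𝒞s (k+1))` for all `k + 1 ≤ N`
(`StepKernelBoundsABKM`; e.g. kernels dominated by `(1+ρ)𝒞_{k+1}` in multipliers,
`StepKernelBoundsDominatedABKM`), the steps

* `rgA L h 𝒞s` (`A_k^{(q)} = stepOpAEquiv γ(𝒞s_{k+1})`), **`rgBQ`** (`B_k^{(q)}` via `opBHomQ`),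
  **`rgSQ`** (`S_k^{(q)}`: `restrictConn ∘ nextKStep (abkmStepData L R k 𝒞s) ∘ mulExt`),

satisfy **`isRGStepQ_abkm_of_stepKernelBounds`**:
`RGFlow.IsRGStepQ N r (3/4) (L^d C_{8.7} A𝒫' A⁻¹) (sigmaABKM d L R A A𝒫' r) (activityNormLE P) rgA rgBQ rgSQ`
with `P` the norm parameters of the `q = 0` weights.  The proof is the one of `isRGStepQ_abkm` with
every `q = 0` step estimate replaced by its `_of_stepKernelBounds` twin.

Everything is proved; no named fact.  Not here: the Lipschitz dependence of `(rgA, rgBQ, rgSQ)` on the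
kernel family (hypotheses `ha`, `hb`, `hl` of `RGFlow.exists_isTunedQ_initial_eq`).

## References
* S. Adams, S. Buchholz, R. Kotecký, S. Müller, arXiv:1910.13564, Theorem 6.8, Lemma 7.7, Ch. 12
  (Theorem 12.1, Lemma 12.6) [AdamsBuchholzKoteckyMuller2019].
-/

noncomputable section

namespace Literature.MathematicalPhysics.StatisticalMechanics.GradientRG

open scoped BigOperators Classical
open Finset MeasureTheory
open Literature.MathematicalPhysics.StatisticalMechanics.TorusPolymer
  (IsPolymer blocks polys bprod blockOf thicken reblock boxCorner mem_polys mem_blocks numBlocks isPolymer_blockOf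
    card_blocks_eq_numBlocks blocks_blockOf empty_mem_polys closure mem_blockOf_self isConn_blockOf)
open Literature.Barriers.CriticalPhenomena.LongRangePhi4.Polymer (IsConn components)
open Literature.MathematicalPhysics.StatisticalMechanics.GradientFRD (iterDiff)
open Literature.MathematicalPhysics.QuantumFieldTheory
open Literature.Dynamics.Hyperbolic

variable {d M : ℕ} [NeZero M]

/-! ## The steps `B_k^{(q)}`, `S_k^{(q)}` for a step-kernel family by predicate -/

/-- **`B_k^{(q)}`** — `K ↦ −Π₂ R^{(q)}_{k+1} K(B_0)` as an additive map into the coefficient space of scale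
`k+1` (`opBHomQ` for the step data `abkmStepData L R k 𝒞s`; `0` beyond the horizon `k ≥ N`).
[cite: AdamsBuchholzKoteckyMuller2019, Theorem 6.8 (the operator B_k)] -/
def rgBQ {L N Mord R n p r₀ : ℕ} {θbar lam μ δ₁ δ₀ A𝒫 A𝒫' C₂ h A : ℝ} {𝒞 𝒞s : ℕ → (Fin d → ZMod M) → ℝ}
    (hB : AbkmWeightBounds L N Mord R n θbar lam μ δ₁ δ₀ A𝒫 𝒞
      (abkmWeightData L N Mord R θbar (schedDelta δ₀ δ₁ N) 𝒞))
    (hr₀ : 2 ≤ r₀) (hLodd : Odd L) (hM : M = L ^ N)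
    (hS : ∀ k, k + 1 ≤ N →
      StepKernelBounds (abkmWeightData L N Mord R θbar (schedDelta δ₀ δ₁ N) 𝒞) L k A𝒫' C₂ (𝒞s (k + 1)))
    (k : ℕ) :
    activitySpace (abkmNormParams L N Mord R p r₀ h θbar A (schedDelta δ₀ δ₁ N) 𝒞) k →+ HamSpace ℂ d (fieldWt h (L : ℝ) d (k + 1)) ((L : ℝ) ^ (k + 1)) (L ^ (d * (k + 1))) :=
  if hk : k + 1 ≤ N then
    (HamSpace.ofHam (𝕜 := ℂ) (d := d) (𝔥 := fieldWt h (L : ℝ) d (k + 1)) (R := (L : ℝ) ^ (k + 1))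
        (n := L ^ (d * (k + 1)))).toLinearMap.toAddMonoidHom.comp
      (opBHomQ (p := p) (A := A) hB hr₀ hLodd hM (abkmStepData L R k 𝒞s) (hS k hk) (x₀ := 0) rfl)
  else 0

/-- **`S_k^{(q)}(x, y)`** — `restrictConn (L^{k+1}) (nextKStep (abkmStepData L R k 𝒞s) x (mulExt y))` bundled as
a member of `activitySpace P (k+1)` (norms of the `q = 0` weights) when it is one, `0` otherwise.
[cite: AdamsBuchholzKoteckyMuller2019, Definition 6.5 (6.34) / Theorem 6.8] -/
def rgSQ {L N Mord R p r₀ : ℕ} {h θbar A δ₀ δ₁ : ℝ} {𝒞 : ℕ → (Fin d → ZMod M) → ℝ}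
    (𝒞s : ℕ → (Fin d → ZMod M) → ℝ) (k : ℕ)
    (x : HamSpace ℂ d (fieldWt h (L : ℝ) d k) ((L : ℝ) ^ k) (L ^ (d * k))) (y : activitySpace (abkmNormParams L N Mord R p r₀ h θbar A (schedDelta δ₀ δ₁ N) 𝒞) k) : activitySpace (abkmNormParams L N Mord R p r₀ h θbar A (schedDelta δ₀ δ₁ N) 𝒞) (k + 1) :=
  if hmem : restrictConn (L ^ (k + 1)) (nextKStep (abkmStepData L R k 𝒞s) (HamSpace.toHam x)
      (mulExt (y : Finset (Fin d → ZMod M) → ((Fin d → ZMod M) → ℝ) → ℂ))) ∈ activitySpace (abkmNormParams L N Mord R p r₀ h θbar A (schedDelta δ₀ δ₁ N) 𝒞) (k + 1) then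
    ⟨_, hmem⟩ else 0

/-- The value of `S_k^{(q)}(x, y)` when the image is admissible. [cite: AdamsBuchholzKoteckyMuller2019, Theorem 6.8] -/
theorem coe_rgSQ_of_mem {L N Mord R p r₀ : ℕ} {h θbar A δ₀ δ₁ : ℝ} {𝒞 𝒞s : ℕ → (Fin d → ZMod M) → ℝ} {k : ℕ}
    {x : HamSpace ℂ d (fieldWt h (L : ℝ) d k) ((L : ℝ) ^ k) (L ^ (d * k))} {y : activitySpace (abkmNormParams L N Mord R p r₀ h θbar A (schedDelta δ₀ δ₁ N) 𝒞) k}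
    (hmem : restrictConn (L ^ (k + 1)) (nextKStep (abkmStepData L R k 𝒞s) (HamSpace.toHam x)
      (mulExt (y : Finset (Fin d → ZMod M) → ((Fin d → ZMod M) → ℝ) → ℂ))) ∈ activitySpace (abkmNormParams L N Mord R p r₀ h θbar A (schedDelta δ₀ δ₁ N) 𝒞) (k + 1)) :
    ((rgSQ (𝒞 := 𝒞) 𝒞s k x y : activitySpace (abkmNormParams L N Mord R p r₀ h θbar A (schedDelta δ₀ δ₁ N) 𝒞) (k + 1)) : Finset (Fin d → ZMod M) → ((Fin d → ZMod M) → ℝ) → ℂ) =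
      restrictConn (L ^ (k + 1)) (nextKStep (abkmStepData L R k 𝒞s) (HamSpace.toHam x)
        (mulExt (y : Finset (Fin d → ZMod M) → ((Fin d → ZMod M) → ℝ) → ℂ))) := by
  unfold rgSQ; rw [dif_pos hmem]

/-! ## `IsRGStepQ` for the concrete data with step kernels by predicate -/

set_option maxHeartbeats 800000 in
/-- **[ABKM19] Theorem 6.8 in the form `RGFlow.IsRGStepQ`, step kernels by predicate** (`q ∈ B_κ`): for
`d ≥ 3`, `L` odd, `L ≥ 2^{d+3} + 16R`, `M = L^N`, the weight tower of Theorem 7.1 (`AbkmWeightBounds`), a family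
of step kernels `𝒞s` with `StepKernelBounds W L k A𝒫' C₂ (𝒞s (k+1))` for `k + 1 ≤ N` and `C₂ ≤ h²`,
`A ≥ 1` large and `r ≤ 1/64` small in the sense of the four conditions of `RenormalisationMapBallABKM`,
the steps `(rgA, rgB, rgS)` satisfy `IsRGStepQ N r (3/4) (L^d C_{8.7} A_𝒫 A^{−1}) σ(r)` for the
predicates `activityNormLE P`. [cite: AdamsBuchholzKoteckyMuller2019, Theorem 6.8] -/
theorem isRGStepQ_abkm_of_stepKernelBounds {L N Mord R n p r₀ : ℕ} {θbar lam μ δ₁ δ₀ A𝒫 A𝒫' C₂ h A : ℝ}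
    {𝒞 𝒞s : ℕ → (Fin d → ZMod M) → ℝ} [∀ j : ℕ, Fact (0 < fieldWt h (L : ℝ) d j)] [∀ j : ℕ, Fact (0 < (L : ℝ) ^ j)] [∀ j : ℕ, Fact (0 < L ^ (d * j))]
    (hd : 3 ≤ d) (hLodd : Odd L) (hL : 2 ^ (d + 3) + 16 * R ≤ L)
    (hR2 : 2 ≤ R) (hM : M = L ^ N)
    (hp : d / 2 + 2 ≤ p) (hpM : p + d ≤ Mord) (hMR : Mord ≤ R) (hr₀ : 3 ≤ r₀)
    (hB : AbkmWeightBounds L N Mord R n θbar lam μ δ₁ δ₀ A𝒫 𝒞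
      (abkmWeightData L N Mord R θbar (schedDelta δ₀ δ₁ N) 𝒞))
    (hδ₀ : 0 < δ₀) (hδ₁ : 0 < δ₁) (hh : 0 < h) (hh0 : hZeroSq d R δ₀ δ₁ ≤ h ^ 2)
    (hS : ∀ k, k + 1 ≤ N → StepKernelBounds (abkmWeightData L N Mord R θbar (schedDelta δ₀ δ₁ N) 𝒞) L k A𝒫' C₂ (𝒞s (k + 1)))
    (hh2 : C₂ ≤ h ^ 2) (hA𝒫 : 0 ≤ A𝒫') (hA1 : 1 ≤ A)
    (hA𝒫A : A𝒫' ≤ A)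
    (hsmall : (2 : ℝ) ^ (L ^ d) * (A𝒫' * A ^ (-(1 - (1 + 1 / ((2 * (2 ^ d + 1) + 6 : ℝ) ^ d))⁻¹) : ℝ)) ≤ 1)
    {r : ℝ} (hr0 : 0 ≤ r) (hr : r ≤ 1 / 64)
    (hv : vABKM d R A A𝒫' r ≤ 1 / 64) (hωA : omegaABKM d R A A𝒫' r * A ^ 2 ≤ 1)
    (hc3A : (kappaABKM d R A A𝒫' r) ^ (L ^ d) * ((2 * (2 * (kappaABKM d R A A𝒫' r) * max 1 A𝒫')) ^ ((2 ^ (d + 1) + 2) ^ d * L ^ d) * (4 : ℝ) ^ ((2 ^ (d + 1) + 2) ^ d * L ^ d)) ≤ A ^ ((1 + 1 / ((2 * (2 ^ d + 1) + 6 : ℝ) ^ d)) - 1 : ℝ))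
    (hc2A : (kappaABKM d R A A𝒫' r) ^ (L ^ d) * ((2 * (kappaABKM d R A A𝒫' r) * max 1 A𝒫') ^ ((2 ^ (d + 1) + 2) ^ d * L ^ d) * (2 : ℝ) ^ ((2 ^ (d + 1) + 2) ^ d * L ^ d)) ≤ A ^ ((1 + 1 / ((2 * (2 ^ d + 1) + 6 : ℝ) ^ d)) - 1 : ℝ)) :
    RGFlow.IsRGStepQ (E := fun k => HamSpace ℂ d (fieldWt h (L : ℝ) d k) ((L : ℝ) ^ k) (L ^ (d * k))) (F := fun k => activitySpace (abkmNormParams L N Mord R p r₀ h θbar A (schedDelta δ₀ δ₁ N) 𝒞) k)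
      N r (3 / 4) ((L : ℝ) ^ d * (pi2BoundConst d (((2 * R + 2 : ℕ) : ℝ) + ((d / 2 + 1 : ℕ) : ℝ)) * (A𝒫' * A⁻¹))) (sigmaABKM d L R A A𝒫' r)
      (activityNormLE (abkmNormParams L N Mord R p r₀ h θbar A (schedDelta δ₀ δ₁ N) 𝒞)) (rgA L h 𝒞s) (rgBQ (p := p) (A := A) hB (by omega) hLodd hM hS)
      (rgSQ (L := L) (N := N) (Mord := Mord) (R := R) (p := p) (r₀ := r₀) (h := h) (θbar := θbar) (A := A)
        (δ₀ := δ₀) (δ₁ := δ₁) (𝒞 := 𝒞) 𝒞s) := by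
  set P := (abkmNormParams L N Mord R p r₀ h θbar A (schedDelta δ₀ δ₁ N) 𝒞) with hP
  have hd2 : 2 ≤ d := by omega
  have h8 : 8 ≤ 2 ^ (d + 3) := by
    calc 8 = 2 ^ 3 := by norm_num
      _ ≤ 2 ^ (d + 3) := Nat.pow_le_pow_right (by norm_num) (by omega)
  have hL4 : 4 ≤ L := by omega
  have hL1 : 1 ≤ L := by omega
  have hL0 : (0 : ℝ) < L := by exact_mod_cast hLodd.pos
  have hA0 : 0 < A := by linarith
  have hPA : 0 < P.A := hA0
  have hMo : Odd M := by rw [hM]; exact hLodd.pow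
  have hC87_0 : 0 ≤ pi2BoundConst d (((2 * R + 2 : ℕ) : ℝ) + ((d / 2 + 1 : ℕ) : ℝ)) := pi2BoundConst_nonneg d (by positivity)
  have hσ0 : 0 ≤ sigmaABKM d L R A A𝒫' r := sigmaABKM_nonneg hLodd.pos hA1 hA𝒫 hr0
  -- per-scale facts
  have hDs : ∀ k, (abkmStepData L R k 𝒞s).s = L ^ k := fun k => rfl
  have hDL : ∀ k, (abkmStepData L R k 𝒞s).L = L := fun k => rfl
  have hB₀ : ∀ k, (abkmStepData L R k 𝒞s).B₀ = blockOf (L ^ k) 0 := fun k => rfl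
  have hc₀ : ∀ k, (abkmStepData L R k 𝒞s).c₀ = boxCorner (L ^ k) (starRad R L d k) 0 := fun k => rfl
  have hB0ne : ∀ k, (abkmStepData L R k 𝒞s).B₀ ≠ ∅ := fun k => Finset.ne_empty_of_mem (mem_blockOf_self (L ^ k) 0)
  have hMt : ∀ k, k ≤ N → M = P.L ^ k * L ^ (N - k) := fun k hk => by
    show M = L ^ k * L ^ (N - k)
    rw [hM, ← pow_add, Nat.add_sub_cancel' hk]
  refine ⟨?_, ?_, ?_, ?_⟩
  · -- `S_k(0, 0) = 0`
    intro k hk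
    have hz : restrictConn (L ^ (k + 1)) (nextKStep (abkmStepData L R k 𝒞s)
        (HamSpace.toHam (0 : HamSpace ℂ d (fieldWt h (L : ℝ) d k) ((L : ℝ) ^ k) (L ^ (d * k))))
        (mulExt (((0 : activitySpace P k) : activitySpace P k) : Finset (Fin d → ZMod M) → ((Fin d → ZMod M) → ℝ) → ℂ))) = 0 := by
      rw [map_zero, Submodule.coe_zero, mulExt_zero]
      funext U
      by_cases hU : IsPolymer (L ^ (k + 1)) U ∧ IsConn U
      · rw [restrictConn_of_conn hU.1 hU.2]
        funext φ
        rw [nextKStep_zero_trivAct _ (hB0ne k) U φ]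
        unfold TorusPolymer.punit
        rw [if_neg (Finset.nonempty_iff_ne_empty.1 hU.2.1)]
        rfl
      · rw [restrictConn_of_not hU]; rfl
    unfold rgSQ
    split_ifs with hmem
    · exact Subtype.ext hz
    · rfl
  · -- the Lipschitz bound on the `r`-ball
    intro k hk x x' y y' cy cy' c hx hx' hy hcy hy' hcy' hyy'
    have hkN : k + 1 ≤ N := hk
    have hsodd : Odd (L ^ k) := hLodd.pow
    set D := abkmStepData L R k 𝒞s with hDdef
    set H := HamSpace.toHam x with hHdef
    set H' := HamSpace.toHam x' with hH'def
    set K := mulExt ((y : activitySpace P k) : Finset (Fin d → ZMod M) → ((Fin d → ZMod M) → ℝ) → ℂ) with hKdef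
    set K' := mulExt ((y' : activitySpace P k) : Finset (Fin d → ZMod M) → ((Fin d → ZMod M) → ℝ) → ℂ) with hK'def
    have hH : hamNorm (fieldWt h (L : ℝ) d k) ((L : ℝ) ^ k) (L ^ (d * k)) H ≤ r := by
      rw [hHdef, ← HamSpace.norm_def]; exact hx
    have hH' : hamNorm (fieldWt h (L : ℝ) d k) ((L : ℝ) ^ k) (L ^ (d * k)) H' ≤ r := by
      rw [hH'def, ← HamSpace.norm_def]; exact hx'
    have hK : WeakNormLE P k K r := (activitySpace.weakNormLE_mulExt y hy).mono hPA hcy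
    have hK' : WeakNormLE P k K' r := (activitySpace.weakNormLE_mulExt y' hy').mono hPA hcy'
    have hKd : ∀ Y, ContDiff ℝ r₀ (K Y) := activitySpace.contDiff_mulExt y
    have hK'd : ∀ Y, ContDiff ℝ r₀ (K' Y) := activitySpace.contDiff_mulExt y'
    have hc0 : 0 ≤ c := nonneg_of_weakNormLE hPA (hMt k (by omega)) hsodd hLodd.pow hyy'
    have hΔ1 : WeakNormLE P k (K - K') c := activitySpace.weakNormLE_mulExt_sub y y' hyy'
    have hΔ2 : WeakNormLE P k (K - K') (r + r) := hK.sub hK' hKd hK'd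
    have hΔ : WeakNormLE P k (K - K') (min c (r + r)) := WeakNormLE.min hPA hΔ1 hΔ2
    have hCΔ : 0 ≤ min c (r + r) := le_min hc0 (by linarith)
    have hCΔ2 : min c (r + r) ≤ 2 * r := (min_le_right _ _).trans (by linarith)
    have hk1L : 1 ≤ L ^ k := Nat.one_le_pow _ _ hLodd.pos
    have hKfac : Factorises (L ^ k) K := factorises_mulExt hk1L
    have hK'fac : Factorises (L ^ k) K' := factorises_mulExt hk1L
    have hK0 : ∀ φ, K ∅ φ = 1 := fun φ => mulExt_empty φ
    have hK'0 : ∀ φ, K' ∅ φ = 1 := fun φ => mulExt_empty φ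
    have hKloc : ∀ Y, IsPolymer (L ^ k) Y → IsConn Y → IsGaugeLocal (P.gauge k Y) (K Y) :=
      fun Y hY hYc => activitySpace.isGaugeLocal_mulExt y hY hYc
    have hK'loc : ∀ Y, IsPolymer (L ^ k) Y → IsConn Y → IsGaugeLocal (P.gauge k Y) (K' Y) :=
      fun Y hY hYc => activitySpace.isGaugeLocal_mulExt y' hY hYc
    have hKt : TransInv (L ^ k) K := activitySpace.transInv_mulExt y
    have hK't : TransInv (L ^ k) K' := activitySpace.transInv_mulExt y'
    -- membership of the two images
    have hmem : restrictConn (L ^ (k + 1)) (nextKStep D H K) ∈ activitySpace P (k + 1) :=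
      restrictConn_nextKStep_mem_activitySpace_of_stepKernelBounds hd hLodd hL hR2 hM hkN hp hpM hMR hr₀ hB hδ₀ hδ₁ hh hh0
        hh2 hA𝒫 hA1 hA𝒫A hsmall D (hDs k) (hDL k) (hS k hkN) (hB₀ k) (hc₀ k) hH hr hK hKfac hK0 hKd hKloc hKt
        hv hωA hc3A hc2A
    have hmem' : restrictConn (L ^ (k + 1)) (nextKStep D H' K') ∈ activitySpace P (k + 1) :=
      restrictConn_nextKStep_mem_activitySpace_of_stepKernelBounds hd hLodd hL hR2 hM hkN hp hpM hMR hr₀ hB hδ₀ hδ₁ hh hh0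
        hh2 hA𝒫 hA1 hA𝒫A hsmall D (hDs k) (hDL k) (hS k hkN) (hB₀ k) (hc₀ k) hH' hr hK' hK'fac hK'0 hK'd hK'loc hK't
        hv hωA hc3A hc2A
    -- the Lipschitz estimate
    have hlip := weakNormLE_nextKStep_sub_abkm_ball_of_stepKernelBounds hd hLodd hL hR2 hM hkN hp hpM hMR hr₀ hB hδ₀ hδ₁ hh hh0
      hh2 hA𝒫 hA1 hA𝒫A hsmall D (hDs k) (hDL k) (hS k hkN) (hB₀ k) (hc₀ k) hH hH' hr hCΔ hK hK' hΔ hCΔ2 hKfac hK0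
      hK'fac hK'0 hKd hK'd hKloc hK'loc hKt hK't hv hωA hc3A hc2A
    have hxx' : hamNorm (fieldWt h (L : ℝ) d k) ((L : ℝ) ^ k) (L ^ (d * k)) (H - H') = ‖x - x'‖ := by
      rw [HamSpace.norm_def, hHdef, hH'def, map_sub]
    have hle : sigmaABKM d L R A A𝒫' r * max (hamNorm (fieldWt h (L : ℝ) d k) ((L : ℝ) ^ k) (L ^ (d * k)) (H - H')) (min c (r + r)) ≤
        sigmaABKM d L R A A𝒫' r * max ‖x - x'‖ c := by
      rw [hxx']
      exact mul_le_mul_of_nonneg_left (max_le_max le_rfl (min_le_left _ _)) hσ0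
    show WeakNormLE P (k + 1) (((rgSQ 𝒞s k x y - rgSQ 𝒞s k x' y' : activitySpace P (k + 1)) :
      Finset (Fin d → ZMod M) → ((Fin d → ZMod M) → ℝ) → ℂ)) (sigmaABKM d L R A A𝒫' r * max ‖x - x'‖ c)
    rw [Submodule.coe_sub, coe_rgSQ_of_mem hmem, coe_rgSQ_of_mem hmem', ← restrictConn_sub]
    exact (weakNormLE_restrictConn_iff (P := P) (k := k + 1)).2 (hlip.mono hPA hle)
  · -- `‖A_k⁻¹‖ ≤ 3/4`
    intro k hk w
    rw [HamSpace.norm_def, HamSpace.norm_def]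
    unfold rgA
    rw [toHam_stepOpAEquiv_symm]
    exact hamNorm_stepOpAInv_abkm_le hd hL4 hh k
      (fun q => abs_gradCov_le_of_stepKernelBounds (hS k hk) hh2 q) _
  · -- `‖B_k y‖ ≤ β ‖y‖_k`
    intro k hk y c hyc
    have hk1 : k + 1 ≤ N + 1 := by omega
    have hc0 : 0 ≤ c := nonneg_of_weakNormLE hPA (hMt k (by omega)) hLodd.pow hLodd.pow hyc
    rw [HamSpace.norm_def]
    unfold rgBQ
    rw [dif_pos (show k + 1 ≤ N from hk)]
    show hamNorm (fieldWt h (L : ℝ) d (k + 1)) ((L : ℝ) ^ (k + 1)) (L ^ (d * (k + 1)))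
      (HamSpace.toHam (HamSpace.ofHam (opBHomQ (p := p) (A := A) hB (by omega) hLodd hM
        (abkmStepData L R k 𝒞s) (hS k hk) (x₀ := 0) rfl y))) ≤ _
    rw [HamSpace.toHam_ofHam, opBHomQ_apply]
    calc hamNorm (fieldWt h (L : ℝ) d (k + 1)) ((L : ℝ) ^ (k + 1)) (L ^ (d * (k + 1)))
          (opB (abkmStepData L R k 𝒞s) (y : Finset (Fin d → ZMod M) → ((Fin d → ZMod M) → ℝ) → ℂ))
        ≤ (L : ℝ) ^ d * (pi2BoundConst d (((2 * R + 2 : ℕ) : ℝ) + ((d / 2 + 1 : ℕ) : ℝ)) * (c * A𝒫' * A⁻¹)) :=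
          hamNorm_opB_abkm_le_of_stepKernelBounds hd hLodd hL hM hk hpM hMR hr₀ hB hh hA1 (abkmStepData L R k 𝒞s) (hS k hk) rfl rfl hc0
            hyc (activitySpace.contDiff y) (fun X hX hXc => activitySpace.isGaugeLocal y hX hXc)
      _ = (L : ℝ) ^ d * (pi2BoundConst d (((2 * R + 2 : ℕ) : ℝ) + ((d / 2 + 1 : ℕ) : ℝ)) * (A𝒫' * A⁻¹)) * c := by ring

end Literature.MathematicalPhysics.StatisticalMechanics.GradientRG

end
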